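import Summits.HodgeConjecture.CorCM.GaloisTwentyFourDegenerateModels
import HarnessLib

/-!
# Mirror CM types in a GENERALISED DIHEDRAL Galois group `Dih(A) = A ⋊₋₁ C₂`, stated inside `Gal(K/ℚ)`

COR-CM (cell `pub-hodgecm2`), binder seat b04 (gen 22), count-neutral claim GALOIS-DIHEDRAL, part IX — the abstract
form of the mechanism of parts I (`DihedralGroup m`, `A = ℤ/m`) and V (`DihedralGroup m × C₂`, `A = ℤ/m × ℤ/2`).
KERNEL ONLY: theorems; no definition, no named fact, no `sorry`.  `HC_CM` is neither used nor claimed.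

SETTING.  A finite group `G` (the Galois group itself; no model type), a subgroup `A ≤ G` whose elements commute,
an element `x ∉ A` with `x² = 1` inverting `A` (`x a x = a⁻¹`) and `A ∪ xA = G` (index `2`); complex conjugation
`c₀ ∈ A` (`c₀² = 1`).  So `G ≅ Dih(A)`.  For a CM HALF `S₁ ⊆ A` (`a ∈ S₁ ⟺ c₀ a ∉ S₁` on `A`) and `t ∈ A` the
MIRROR TYPE is `T = S₁ ⊔ {x a : t a⁻¹ ∈ S₁}` and its companion `D = S₁ ⊔ {x a : t a⁻¹ ∉ S₁}`.  Exactly as in part I: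
`T` is a CM set (§2), `D` is BALANCED — `2·#{y ∈ D : y g ∈ T} = #D` for all `g`, by the symmetry
`#{a ∈ S₁ : a j ∈ S₁} = #{a ∈ S₁ : a j⁻¹ ∈ S₁}` of the autocorrelation (§1) — and moved by `c₀`, so `T` is DEGENERATE;
its left stabiliser is trivial iff `S₁` is APERIODIC (`j S₁ ≠ S₁`, `j ∈ A ∖ 1`) and ASYMMETRIC (`u S₁⁻¹ ≠ S₁`, `u ∈ A`)
(§3).  §4 **`exists_simple_degenerate_of_generalisedDihedral_mirror`**: for a Galois CM field `K` whose Galois group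
is generalised dihedral in this sense, an aperiodic asymmetric CM half of `A` yields a SIMPLE DEGENERATE abelian variety of
dimension `[K:ℚ]/2` with an exceptional Hodge class on a power (gen 19/20 certificate format with the identity model).
Instances: `A` cyclic (part III: `D_{4n}`, `n ≥ 6`), `A = ℤ/2n × ℤ/2` (parts VI: `D_{2n} × C₂`, `n ≥ 4`); any
`D_{2n} × C₂^r`, `Dih(ℤ/m × ℤ/m')`, … once a half is written down.

## References

* [Shimura1998] G. Shimura, *Abelian Varieties with Complex Multiplication and Modular Functions*, §6.2 Thm. 3,
  §8.2 Prop. 26, §18.2 Lemma (i).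
* [Gordon1999HodgeAVSurvey] B. B. Gordon, *A survey of the Hodge conjecture for abelian varieties*, Thm. 6.4, §9.3.
* [Kubota1965] T. Kubota, Trans. AMS 118 (1965), §2.
-/

noncomputable section

open CategoryTheory CategoryTheory.Limits NumberField
open scoped BigOperators

namespace Summit.HodgeConjecture.CorCM.GaloisDihedralGeneralised

open Literature.NumberTheory.ComplexMultiplication
open Literature.AlgebraicGeometry.Motives (AbelianVariety CMType)
open Literature.AlgebraicGeometry.HodgeTheory
open Literature.AlgebraicGeometry.ComplexMultiplication (IsCMTypeRealisation)
open Literature.AlgebraicGeometry.Pohlmann1968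
open Literature.Barriers.HodgeConjecture (divisorClassesSpan)
open Summit.HodgeConjecture.CorCM.GaloisModels

variable {G : Type*} [Group G] [Fintype G] [DecidableEq G]
variable {A : Subgroup G} [DecidablePred (· ∈ A)]

/-! ## §1 Counting inside the abelian subgroup `A` -/

section Counting

omit [DecidableEq G] in
/-- Counting through a right translation of `A`: `#{a ∈ A : R (a j)} = #{a ∈ A : R a}` (`j ∈ A`). [folklore] -/
theorem card_filter_mul_right (R : G → Prop) [DecidablePred R] {j : G} (hj : j ∈ A) :
    (Finset.univ.filter fun a => a ∈ A ∧ R (a * j)).card = (Finset.univ.filter fun a => a ∈ A ∧ R a).card := by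
  refine Finset.card_bij (fun a _ => a * j) (fun a ha => ?_) (fun a₁ _ a₂ _ h => mul_right_cancel h)
    (fun b hb => ?_)
  · simp only [Finset.mem_filter, Finset.mem_univ, true_and] at ha ⊢
    exact ⟨A.mul_mem ha.1 hj, ha.2⟩
  · simp only [Finset.mem_filter, Finset.mem_univ, true_and] at hb
    refine ⟨b * j⁻¹, ?_, by rw [inv_mul_cancel_right]⟩
    simp only [Finset.mem_filter, Finset.mem_univ, true_and, inv_mul_cancel_right]
    exact ⟨A.mul_mem hb.1 (A.inv_mem hj), hb.2⟩

omit [DecidableEq G] in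
/-- Counting through a reflection of `A`: `#{a ∈ A : R (t a⁻¹)} = #{a ∈ A : R a}` (`t ∈ A`). [folklore] -/
theorem card_filter_reflect (R : G → Prop) [DecidablePred R] {t : G} (ht : t ∈ A) :
    (Finset.univ.filter fun a => a ∈ A ∧ R (t * a⁻¹)).card = (Finset.univ.filter fun a => a ∈ A ∧ R a).card := by
  refine Finset.card_bij (fun a _ => t * a⁻¹) (fun a ha => ?_) (fun a₁ _ a₂ _ h => ?_) (fun b hb => ?_)
  · simp only [Finset.mem_filter, Finset.mem_univ, true_and] at ha ⊢
    exact ⟨A.mul_mem ht (A.inv_mem ha.1), ha.2⟩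
  · exact inv_injective (mul_left_cancel h)
  · simp only [Finset.mem_filter, Finset.mem_univ, true_and] at hb
    refine ⟨b⁻¹ * t, ?_, by rw [mul_inv_rev, inv_inv, mul_inv_cancel_left]⟩
    simp only [Finset.mem_filter, Finset.mem_univ, true_and, mul_inv_rev, inv_inv, mul_inv_cancel_left]
    exact ⟨A.mul_mem (A.inv_mem hb.1) ht, hb.2⟩

/-- **Symmetry of the autocorrelation** inside `A`: `#{a ∈ S₁ : a j ∈ S₁} = #{a ∈ S₁ : a j⁻¹ ∈ S₁}`. [folklore] -/
theorem card_autocorrelation_symm (S₁ : Finset G) {j : G} (hj : j ∈ A) :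
    (Finset.univ.filter fun a => a ∈ A ∧ (a ∈ S₁ ∧ a * j ∈ S₁)).card =
      (Finset.univ.filter fun a => a ∈ A ∧ (a ∈ S₁ ∧ a * j⁻¹ ∈ S₁)).card := by
  rw [← card_filter_mul_right (fun a => a ∈ S₁ ∧ a * j⁻¹ ∈ S₁) hj]
  congr 1
  refine Finset.filter_congr fun a _ => ?_
  rw [mul_inv_cancel_right, and_comm (a := a * j ∈ S₁)]

/-- `#{u ∈ A ∖ S₁ : u j ∈ S₁} + #{u ∈ S₁ : u j ∈ S₁} = #S₁` (`S₁ ⊆ A`, `j ∈ A`). [folklore] -/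
theorem card_filter_not_mem_add (S₁ : Finset G) (hS₁ : ∀ s ∈ S₁, s ∈ A) {j : G} (hj : j ∈ A) :
    (Finset.univ.filter fun u => u ∈ A ∧ (u ∉ S₁ ∧ u * j ∈ S₁)).card +
      (Finset.univ.filter fun u => u ∈ A ∧ (u ∈ S₁ ∧ u * j ∈ S₁)).card = S₁.card := by
  have hs : (Finset.univ.filter fun u : G => u ∈ A ∧ u * j ∈ S₁).card = S₁.card := by
    rw [card_filter_mul_right (fun u => u ∈ S₁) hj]
    congr 1
    ext u
    simp only [Finset.mem_filter, Finset.mem_univ, true_and]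
    exact ⟨fun h => h.2, fun h => ⟨hS₁ u h, h⟩⟩
  rw [← hs, ← Finset.card_filter_add_card_filter_not
    (s := Finset.univ.filter fun u : G => u ∈ A ∧ u * j ∈ S₁) (fun u => u ∉ S₁), Finset.filter_filter,
    Finset.filter_filter]
  congr 2
  · exact Finset.filter_congr fun u _ => by tauto
  · exact Finset.filter_congr fun u _ => by rw [not_not]; tauto

/-- **A CM half of `A` has `|A|/2` elements**: `2 · #S₁ = #A`. [folklore] -/
theorem two_mul_card_of_half (S₁ : Finset G) (hS₁ : ∀ s ∈ S₁, s ∈ A) {c₀ : G} (hc : c₀ ∈ A)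
    (hS : ∀ a ∈ A, (a ∈ S₁ ↔ c₀ * a ∉ S₁)) :
    2 * S₁.card = (Finset.univ.filter fun a : G => a ∈ A).card := by
  set SA := Finset.univ.filter fun a : G => a ∈ A with hSA
  have hsub : S₁ ⊆ SA := fun s hs => by rw [hSA, Finset.mem_filter]; exact ⟨Finset.mem_univ _, hS₁ s hs⟩
  have himage : SA \ S₁ = S₁.image fun a => c₀ * a := by
    ext u
    simp only [Finset.mem_sdiff, Finset.mem_image, hSA, Finset.mem_filter, Finset.mem_univ, true_and]
    constructor
    · rintro ⟨huA, huS⟩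
      refine ⟨c₀⁻¹ * u, ?_, by rw [mul_inv_cancel_left]⟩
      have hcu : c₀⁻¹ * u ∈ A := A.mul_mem (A.inv_mem hc) huA
      rw [hS _ hcu, mul_inv_cancel_left]
      exact huS
    · rintro ⟨a, ha, rfl⟩
      exact ⟨A.mul_mem hc (hS₁ a ha), (hS a (hS₁ a ha)).1 ha⟩
  have h1 : (SA \ S₁).card = S₁.card := by
    rw [himage, Finset.card_image_of_injective _ (mul_right_injective c₀)]
  have h2 := Finset.card_sdiff_add_card_eq_card hsub
  omega

/-- Counting `G = A ⊔ xA` sheet by sheet: `#{g : Q g} = #{a ∈ A : Q a} + #{a ∈ A : Q (x a)}`. [folklore] -/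
theorem card_filter_sheets {x : G} (hx : x ∉ A) (hx2 : x * x = 1) (hidx : ∀ g : G, g ∈ A ∨ x * g ∈ A)
    (Q : G → Prop) [DecidablePred Q] :
    (Finset.univ.filter Q).card =
      (Finset.univ.filter fun a => a ∈ A ∧ Q a).card + (Finset.univ.filter fun a => a ∈ A ∧ Q (x * a)).card := by
  have hxa : ∀ a ∈ A, x * a ∉ A := fun a ha h => hx (by
    have := A.mul_mem h (A.inv_mem ha); rwa [mul_inv_cancel_right] at this)
  have hsplit : (Finset.univ.filter Q) =
      (Finset.univ.filter fun a => a ∈ A ∧ Q a) ∪ ((Finset.univ.filter fun a => a ∈ A ∧ Q (x * a)).image (x * ·)) := by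
    ext g
    simp only [Finset.mem_union, Finset.mem_filter, Finset.mem_univ, true_and, Finset.mem_image]
    constructor
    · intro hQ
      rcases hidx g with hg | hg
      · exact Or.inl ⟨hg, hQ⟩
      · refine Or.inr ⟨x * g, ⟨hg, ?_⟩, ?_⟩ <;> rw [← mul_assoc, hx2, one_mul]
        exact hQ
    · rintro (⟨-, hQ⟩ | ⟨a, ⟨-, hQ⟩, rfl⟩) <;> exact hQ
  rw [hsplit, Finset.card_union_of_disjoint, Finset.card_image_of_injective _ (mul_right_injective x)]
  rw [Finset.disjoint_left]
  rintro g hg1 hg2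
  simp only [Finset.mem_filter, Finset.mem_univ, true_and, Finset.mem_image] at hg1 hg2
  obtain ⟨a, ⟨ha, -⟩, rfl⟩ := hg2
  exact hxa a ha hg1.1

end Counting

/-! ## §2 The mirror type and its companion: existence, CM property -/

section Mirror

variable {x c₀ t : G} {S₁ T D : Finset G}

/-- **The mirror type exists**: on `A`, `a ∈ T ↔ a ∈ S₁`; on `xA`, `x a ∈ T ↔ t a⁻¹ ∈ S₁`. [folklore] -/
theorem exists_mirror (hx : x ∉ A) (hx2 : x * x = 1) (S₁ : Finset G) (t : G) :
    ∃ T : Finset G, (∀ a ∈ A, (a ∈ T ↔ a ∈ S₁)) ∧ (∀ a ∈ A, (x * a ∈ T ↔ t * a⁻¹ ∈ S₁)) := by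
  have hxa : ∀ a ∈ A, x * a ∉ A := fun a ha h => hx (by
    have := A.mul_mem h (A.inv_mem ha); rwa [mul_inv_cancel_right] at this)
  refine ⟨Finset.univ.filter fun g => (g ∈ A ∧ g ∈ S₁) ∨ (g ∉ A ∧ t * (x * g)⁻¹ ∈ S₁), fun a ha => ?_,
    fun a ha => ?_⟩
  · simp only [Finset.mem_filter, Finset.mem_univ, true_and]
    exact ⟨fun h => h.elim (fun h => h.2) (fun h => absurd ha h.1), fun h => Or.inl ⟨ha, h⟩⟩
  · simp only [Finset.mem_filter, Finset.mem_univ, true_and, ← mul_assoc, hx2, one_mul]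
    exact ⟨fun h => h.elim (fun h => absurd h.1 (hxa a ha)) (fun h => h.2), fun h => Or.inr ⟨hxa a ha, h⟩⟩

/-- **The companion set exists**: on `A`, `a ∈ D ↔ a ∈ S₁`; on `xA`, `x a ∈ D ↔ t a⁻¹ ∉ S₁`. [folklore] -/
theorem exists_comirror (hx : x ∉ A) (hx2 : x * x = 1) (S₁ : Finset G) (t : G) :
    ∃ D : Finset G, (∀ a ∈ A, (a ∈ D ↔ a ∈ S₁)) ∧ (∀ a ∈ A, (x * a ∈ D ↔ t * a⁻¹ ∉ S₁)) := by
  have hxa : ∀ a ∈ A, x * a ∉ A := fun a ha h => hx (by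
    have := A.mul_mem h (A.inv_mem ha); rwa [mul_inv_cancel_right] at this)
  refine ⟨Finset.univ.filter fun g => (g ∈ A ∧ g ∈ S₁) ∨ (g ∉ A ∧ t * (x * g)⁻¹ ∉ S₁), fun a ha => ?_,
    fun a ha => ?_⟩
  · simp only [Finset.mem_filter, Finset.mem_univ, true_and]
    exact ⟨fun h => h.elim (fun h => h.2) (fun h => absurd ha h.1), fun h => Or.inl ⟨ha, h⟩⟩
  · simp only [Finset.mem_filter, Finset.mem_univ, true_and, ← mul_assoc, hx2, one_mul]
    exact ⟨fun h => h.elim (fun h => absurd h.1 (hxa a ha)) (fun h => h.2), fun h => Or.inr ⟨hxa a ha, h⟩⟩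

omit [Fintype G] [DecidableEq G] [DecidablePred (· ∈ A)] in
/-- `a x = x a⁻¹` from `x a x = a⁻¹`, `x² = 1`. [folklore] -/
theorem mul_x_eq (hx2 : x * x = 1) (hinv : ∀ a ∈ A, x * a * x = a⁻¹) {a : G} (ha : a ∈ A) :
    a * x = x * a⁻¹ := by
  calc a * x = (x * x) * (a * x) := by rw [hx2, one_mul]
    _ = x * (x * a * x) := by simp only [mul_assoc]
    _ = x * a⁻¹ := by rw [hinv a ha]

omit [Fintype G] [DecidableEq G] [DecidablePred (· ∈ A)] in
/-- **The mirror type is a CM set for `c₀`**: `g ∈ T ↔ c₀ g ∉ T`. [cite: Shimura1998, §18.2 Lemma (i)] -/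
theorem mirror_mem_iff (hcomm : ∀ a ∈ A, ∀ b ∈ A, a * b = b * a) (hx2 : x * x = 1)
    (hinv : ∀ a ∈ A, x * a * x = a⁻¹) (hidx : ∀ g : G, g ∈ A ∨ x * g ∈ A) (hcA : c₀ ∈ A) (hc2 : c₀ * c₀ = 1)
    (ht : t ∈ A) (hS : ∀ a ∈ A, (a ∈ S₁ ↔ c₀ * a ∉ S₁)) (hTa : ∀ a ∈ A, (a ∈ T ↔ a ∈ S₁))
    (hTx : ∀ a ∈ A, (x * a ∈ T ↔ t * a⁻¹ ∈ S₁)) (g : G) : g ∈ T ↔ c₀ * g ∉ T := by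
  rcases hidx g with hg | hg
  · rw [hTa g hg, hTa _ (A.mul_mem hcA hg)]
    exact hS g hg
  · -- `g = x a` with `a = x g ∈ A`
    have hgx : g = x * (x * g) := by rw [← mul_assoc, hx2, one_mul]
    have hc_inv : c₀⁻¹ = c₀ := inv_eq_of_mul_eq_one_right hc2
    have key : c₀ * g = x * (c₀ * (x * g)) := by
      conv_lhs => rw [hgx]
      rw [← mul_assoc, mul_x_eq hx2 hinv hcA, hc_inv, mul_assoc]
    have L := hTx (x * g) hg
    rw [← hgx] at L
    have R : c₀ * g ∈ T ↔ c₀ * (t * (x * g)⁻¹) ∈ S₁ := by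
      rw [key, hTx _ (A.mul_mem hcA hg), mul_inv_rev, hc_inv, ← mul_assoc,
        hcomm (t * (x * g)⁻¹) (A.mul_mem ht (A.inv_mem hg)) c₀ hcA]
    rw [L, R]
    exact hS _ (A.mul_mem ht (A.inv_mem hg))

omit [Fintype G] [DecidableEq G] [DecidablePred (· ∈ A)] in
/-- **The companion set is moved by `c₀`.** [folklore] -/
theorem comirror_moved (hcA : c₀ ∈ A) (hne : S₁.Nonempty) (hS₁ : ∀ s ∈ S₁, s ∈ A)
    (hS : ∀ a ∈ A, (a ∈ S₁ ↔ c₀ * a ∉ S₁)) (hDa : ∀ a ∈ A, (a ∈ D ↔ a ∈ S₁)) :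
    ∃ y ∈ D, c₀ * y ∉ D := by
  obtain ⟨k₀, hk₀⟩ := hne
  have hk₀A := hS₁ k₀ hk₀
  exact ⟨k₀, (hDa k₀ hk₀A).2 hk₀, by rw [hDa _ (A.mul_mem hcA hk₀A)]; exact (hS k₀ hk₀A).1 hk₀⟩

/-! ## §3 The balanced companion set and the left stabiliser -/

/-- **THE BALANCED SET**: `2 · #{y ∈ D : y g ∈ T} = #D` for every `g`. [cite: Gordon1999HodgeAVSurvey, §9.3] -/
theorem mirror_balanced (hcomm : ∀ a ∈ A, ∀ b ∈ A, a * b = b * a) (hx : x ∉ A) (hx2 : x * x = 1)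
    (hinv : ∀ a ∈ A, x * a * x = a⁻¹) (hidx : ∀ g : G, g ∈ A ∨ x * g ∈ A) (hcA : c₀ ∈ A) (ht : t ∈ A)
    (hS₁ : ∀ s ∈ S₁, s ∈ A) (hS : ∀ a ∈ A, (a ∈ S₁ ↔ c₀ * a ∉ S₁)) (hTa : ∀ a ∈ A, (a ∈ T ↔ a ∈ S₁))
    (hTx : ∀ a ∈ A, (x * a ∈ T ↔ t * a⁻¹ ∈ S₁)) (hDa : ∀ a ∈ A, (a ∈ D ↔ a ∈ S₁))
    (hDx : ∀ a ∈ A, (x * a ∈ D ↔ t * a⁻¹ ∉ S₁)) (g : G) :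
    2 * (D.filter fun y => y * g ∈ T).card = D.card := by
  have hcard := two_mul_card_of_half S₁ hS₁ hcA hS
  -- `#D = #A`
  have hD : D.card = (Finset.univ.filter fun a : G => a ∈ A).card := by
    have h1 : D = Finset.univ.filter fun y => y ∈ D := by simp
    rw [h1, card_filter_sheets hx hx2 hidx]
    have e1 : (Finset.univ.filter fun a : G => a ∈ A ∧ a ∈ D) = S₁ := by
      ext a; simp only [Finset.mem_filter, Finset.mem_univ, true_and]
      exact ⟨fun h => (hDa a h.1).1 h.2, fun h => ⟨hS₁ a h, (hDa a (hS₁ a h)).2 h⟩⟩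
    have e2 : (Finset.univ.filter fun a : G => a ∈ A ∧ x * a ∈ D).card =
        (Finset.univ.filter fun a : G => a ∈ A ∧ a ∉ S₁).card := by
      rw [← card_filter_reflect (fun u => u ∉ S₁) ht]
      congr 1
      exact Finset.filter_congr fun a _ => ⟨fun h => ⟨h.1, (hDx a h.1).1 h.2⟩, fun h => ⟨h.1, (hDx a h.1).2 h.2⟩⟩
    have e3 : (Finset.univ.filter fun a : G => a ∈ A ∧ a ∉ S₁).card + S₁.card =
        (Finset.univ.filter fun a : G => a ∈ A).card := by
      have := Finset.card_filter_add_card_filter_not (s := Finset.univ.filter fun a : G => a ∈ A) (fun a => a ∉ S₁)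
      rw [Finset.filter_filter, Finset.filter_filter] at this
      rw [← this]
      congr 2
      ext a; simp only [Finset.mem_filter, Finset.mem_univ, true_and, not_not]
      exact ⟨fun h => ⟨hS₁ a h, h⟩, fun h => h.2⟩
    rw [e1, e2]; omega
  have hfilter : (D.filter fun y => y * g ∈ T) = Finset.univ.filter fun y => y ∈ D ∧ y * g ∈ T := by ext y; simp
  rw [hD, hfilter, card_filter_sheets hx hx2 hidx]
  rcases hidx g with hg | hg
  · -- `g = b ∈ A`
    have e1 : (Finset.univ.filter fun a : G => a ∈ A ∧ (a ∈ D ∧ a * g ∈ T)).card =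
        (Finset.univ.filter fun a : G => a ∈ A ∧ (a ∈ S₁ ∧ a * g ∈ S₁)).card := by
      congr 1
      refine Finset.filter_congr fun a _ => ⟨fun h => ⟨h.1, (hDa a h.1).1 h.2.1, (hTa _ (A.mul_mem h.1 hg)).1 h.2.2⟩,
        fun h => ⟨h.1, (hDa a h.1).2 h.2.1, (hTa _ (A.mul_mem h.1 hg)).2 h.2.2⟩⟩
    have e2 : (Finset.univ.filter fun a : G => a ∈ A ∧ (x * a ∈ D ∧ x * a * g ∈ T)).card =
        (Finset.univ.filter fun u : G => u ∈ A ∧ (u ∉ S₁ ∧ u * g⁻¹ ∈ S₁)).card := by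
      rw [← card_filter_reflect (fun u => u ∉ S₁ ∧ u * g⁻¹ ∈ S₁) ht]
      congr 1
      refine Finset.filter_congr fun a _ => ?_
      constructor
      · rintro ⟨ha, hD', hT'⟩
        refine ⟨ha, (hDx a ha).1 hD', ?_⟩
        rw [mul_assoc, hTx _ (A.mul_mem ha hg), mul_inv_rev, hcomm g⁻¹ (A.inv_mem hg) a⁻¹ (A.inv_mem ha),
          ← mul_assoc] at hT'
        exact hT'
      · rintro ⟨ha, hD', hT'⟩
        refine ⟨ha, (hDx a ha).2 hD', ?_⟩
        rw [mul_assoc, hTx _ (A.mul_mem ha hg), mul_inv_rev, hcomm g⁻¹ (A.inv_mem hg) a⁻¹ (A.inv_mem ha),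
          ← mul_assoc]
        exact hT'
    have h3 := card_filter_not_mem_add S₁ hS₁ (A.inv_mem hg)
    have h4 := card_autocorrelation_symm S₁ hg
    rw [e1, e2]; omega
  · -- `g = x b`, `b = x g ∈ A`
    have hgx : g = x * (x * g) := by rw [← mul_assoc, hx2, one_mul]
    set b := x * g with hb
    have htb : t * b⁻¹ ∈ A := A.mul_mem ht (A.inv_mem hg)
    have e1 : (Finset.univ.filter fun a : G => a ∈ A ∧ (a ∈ D ∧ a * g ∈ T)).card =
        (Finset.univ.filter fun a : G => a ∈ A ∧ (a ∈ S₁ ∧ a * (t * b⁻¹) ∈ S₁)).card := by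
      congr 1
      refine Finset.filter_congr fun a _ => ?_
      have key : ∀ (ha : a ∈ A), (a * g ∈ T ↔ a * (t * b⁻¹) ∈ S₁) := fun ha => by
        have e : t * (a⁻¹ * b)⁻¹ = a * (t * b⁻¹) := by
          rw [mul_inv_rev, inv_inv, ← mul_assoc]; exact hcomm _ htb _ ha
        rw [hgx, show a * (x * b) = x * (a⁻¹ * b) by rw [← mul_assoc, mul_x_eq hx2 hinv ha, mul_assoc],
          hTx _ (A.mul_mem (A.inv_mem ha) hg), e]
      exact ⟨fun h => ⟨h.1, (hDa a h.1).1 h.2.1, (key h.1).1 h.2.2⟩,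
        fun h => ⟨h.1, (hDa a h.1).2 h.2.1, (key h.1).2 h.2.2⟩⟩
    have e2 : (Finset.univ.filter fun a : G => a ∈ A ∧ (x * a ∈ D ∧ x * a * g ∈ T)).card =
        (Finset.univ.filter fun u : G => u ∈ A ∧ (u ∉ S₁ ∧ u * (t⁻¹ * b) ∈ S₁)).card := by
      rw [← card_filter_reflect (fun u => u ∉ S₁ ∧ u * (t⁻¹ * b) ∈ S₁) ht]
      congr 1
      refine Finset.filter_congr fun a _ => ?_
      have key : ∀ (ha : a ∈ A), (x * a * g ∈ T ↔ t * a⁻¹ * (t⁻¹ * b) ∈ S₁) := fun ha => by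
        have e : x * a * g = a⁻¹ * b := by
          rw [hgx]
          calc x * a * (x * b) = (x * a * x) * b := by simp only [mul_assoc]
            _ = a⁻¹ * b := by rw [hinv a ha]
        have e' : t * a⁻¹ * (t⁻¹ * b) = a⁻¹ * b := by
          rw [hcomm t ht a⁻¹ (A.inv_mem ha)]; group
        rw [e, e', hTa _ (A.mul_mem (A.inv_mem ha) hg)]
      exact ⟨fun h => ⟨h.1, (hDx a h.1).1 h.2.1, (key h.1).1 h.2.2⟩,
        fun h => ⟨h.1, (hDx a h.1).2 h.2.1, (key h.1).2 h.2.2⟩⟩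
    have h3 := card_filter_not_mem_add S₁ hS₁ (A.mul_mem (A.inv_mem ht) hg)
    have h4 := card_autocorrelation_symm S₁ htb
    have e5 : (t * b⁻¹)⁻¹ = t⁻¹ * b := by
      rw [mul_inv_rev, inv_inv, hcomm b hg t⁻¹ (A.inv_mem ht)]
    rw [e5] at h4
    rw [e1, e2]; omega

omit [Fintype G] [DecidableEq G] [DecidablePred (· ∈ A)] in
/-- **Trivial left stabiliser** of the mirror type when `S₁` is aperiodic and asymmetric in `A`.
[cite: Shimura1998, §8.2 Prop. 26] -/
theorem mirror_leftStabiliser (hcomm : ∀ a ∈ A, ∀ b ∈ A, a * b = b * a) (hx2 : x * x = 1)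
    (hidx : ∀ g : G, g ∈ A ∨ x * g ∈ A) (ht : t ∈ A)
    (haper : ∀ j ∈ A, j ≠ 1 → ∃ a ∈ A, ¬ (a ∈ S₁ ↔ j * a ∈ S₁))
    (hasym : ∀ u ∈ A, ∃ a ∈ A, ¬ (a ∈ S₁ ↔ u * a⁻¹ ∈ S₁))
    (hTa : ∀ a ∈ A, (a ∈ T ↔ a ∈ S₁)) (hTx : ∀ a ∈ A, (x * a ∈ T ↔ t * a⁻¹ ∈ S₁)) (v : G) (hv : v ≠ 1) :
    ∃ w : G, ¬ (w ∈ T ↔ v * w ∈ T) := by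
  rcases hidx v with hvA | hvA
  · obtain ⟨a, ha, hk⟩ := haper v hvA hv
    exact ⟨a, by rwa [hTa a ha, hTa _ (A.mul_mem hvA ha)]⟩
  · -- `v = x b`, `b = x v`
    have hvx : v = x * (x * v) := by rw [← mul_assoc, hx2, one_mul]
    obtain ⟨a, ha, hk⟩ := hasym (t * (x * v)⁻¹) (A.mul_mem ht (A.inv_mem hvA))
    refine ⟨a, ?_⟩
    rw [hTa a ha, hvx, mul_assoc, hTx _ (A.mul_mem hvA ha), mul_inv_rev,
      hcomm a⁻¹ (A.inv_mem ha) (x * v)⁻¹ (A.inv_mem hvA), ← mul_assoc]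
    exact hk

end Mirror

/-! ## §4 Field level -/

section Field

variable {K : Type} [Field K] [NumberField K] [IsCMField K] [IsGalois ℚ K]

/-- **THEOREM (generalised dihedral Galois groups).**  Let the Galois group of the Galois CM field `K` contain a
subgroup `A` of commuting elements and an element `x ∉ A` with `x² = 1` inverting `A`, `A ∪ xA = Gal(K/ℚ)`, complex
conjugation `c ∈ A`.  If `A` has an APERIODIC ASYMMETRIC CM HALF `S₁` (`a ∈ S₁ ⟺ c a ∉ S₁` on `A`; no `j S₁ = S₁`,
`j ∈ A ∖ 1`; no `u S₁⁻¹ = S₁`, `u ∈ A`), then `K` has a SIMPLE DEGENERATE abelian variety of dimension `[K:ℚ]/2` with CM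
by `K` and an exceptional Hodge class on some power. [cite: Shimura1998, §6.2 Thm. 3 and §8.2 Prop. 26]
[cite: Gordon1999HodgeAVSurvey, Thm. 6.4 and §9.3] [cite: Kubota1965, §2] -/
theorem exists_simple_degenerate_of_generalisedDihedral_mirror (A : Subgroup (K ≃ₐ[ℚ] K))
    (hcomm : ∀ a ∈ A, ∀ b ∈ A, a * b = b * a) (x : K ≃ₐ[ℚ] K) (hx : x ∉ A) (hx2 : x * x = 1)
    (hinv : ∀ a ∈ A, x * a * x = a⁻¹) (hidx : ∀ g : K ≃ₐ[ℚ] K, g ∈ A ∨ x * g ∈ A)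
    (hcA : (IsCMField.complexConj K).restrictScalars ℚ ∈ A) (S₁ : Finset (K ≃ₐ[ℚ] K)) (hne : S₁.Nonempty)
    (hS₁ : ∀ s ∈ S₁, s ∈ A)
    (hS : ∀ a ∈ A, (a ∈ S₁ ↔ (IsCMField.complexConj K).restrictScalars ℚ * a ∉ S₁)) (t : K ≃ₐ[ℚ] K) (ht : t ∈ A)
    (haper : ∀ j ∈ A, j ≠ 1 → ∃ a ∈ A, ¬ (a ∈ S₁ ↔ j * a ∈ S₁))
    (hasym : ∀ u ∈ A, ∃ a ∈ A, ¬ (a ∈ S₁ ↔ u * a⁻¹ ∈ S₁)) :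
    ∃ (Φ : CMType K) (φ₀ : K →+* ℂ) (B : AbelianVariety ℂ) (ι : 𝓞 K →+* End B)
      (θ : K →+* Module.End ℂ (complexBetti B.X 1)),
      IsPrimitive (ℂ ≃+* ℂ) Φ.1 φ₀ ∧ ¬ IsNondegenerate Φ ∧ IsCMTypeRealisation Φ B ι θ ∧ B.IsSimple ∧
      B.dim = Module.finrank ℚ K / 2 ∧
      ∃ n p : ℕ, ∃ y : complexBetti (⨁ fun _ : Fin n => B).X (2 * p), IsRationalClass y ∧
        IsOfHodgeType (⨁ fun _ : Fin n => B).dim (⨁ fun _ : Fin n => B).X (2 * p) p p y ∧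
        y ∉ divisorClassesSpan (⨁ fun _ : Fin n => B).X (⨁ fun _ : Fin n => B).dim p := by
  classical
  set c₀ := (IsCMField.complexConj K).restrictScalars ℚ with hc₀
  have hc2 : c₀ * c₀ = 1 := GaloisRank.model_complexConj_mul_self (MulEquiv.refl _) rfl
  obtain ⟨T, hTa, hTx⟩ := exists_mirror (A := A) hx hx2 S₁ t
  obtain ⟨D, hDa, hDx⟩ := exists_comirror (A := A) hx hx2 S₁ t
  have hmain := exists_simple_degenerate_of_model_balanced (MulEquiv.refl (K ≃ₐ[ℚ] K)) c₀ rfl T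
    (mirror_mem_iff hcomm hx2 hinv hidx hcA hc2 ht hS hTa hTx)
    (mirror_leftStabiliser hcomm hx2 hidx ht haper hasym hTa hTx) D
    (mirror_balanced hcomm hx hx2 hinv hidx hcA ht hS₁ hS hTa hTx hDa hDx) (comirror_moved hcA hne hS₁ hS hDa)
  rwa [← Nat.card_eq_fintype_card, IsGalois.card_aut_eq_finrank] at hmain

end Field

end Summit.HodgeConjecture.CorCM.GaloisDihedralGeneralised

end
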